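import Mathlib
import HarnessLib
import Literature.Analysis.FluidPDE.TypeIAncientMild
import Literature.Analysis.FluidPDE.LocalTypeI
import Literature.Analysis.FluidPDE.ClassicalSolution
import Summits.NavierStokesRegularity.NavierStokesRegularity.Theorems.SymmetryModuliCountForcedSymmetryBlowDownResidual
import Summits.NavierStokesRegularity.NavierStokesRegularity.Theorems.SymmetryModuliCountForcedSymmetrySingularBlowDownLimit
import Summits.NavierStokesRegularity.NavierStokesRegularity.Theorems.SymmetryModuliCountForcedSymmetryStubPressureStructure
import Summits.NavierStokesRegularity.NavierStokesRegularity.Theorems.SymmetryModuliCountForcedSymmetryStubSliceOscillation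
import Summits.NavierStokesRegularity.NavierStokesRegularity.Theorems.SymmetryModuliCountForcedSymmetryStubOscTimeIntegration
import Summits.NavierStokesRegularity.NavierStokesRegularity.Theorems.SymmetryModuliCountForcedSymmetryStubOscAllScales
import Summits.NavierStokesRegularity.NavierStokesRegularity.Theorems.SymmetryModuliCountForcedSymmetryStubSlabProfileOfBounds

/-!
# Crux `ForcedSymmetry` (stmt-NavierStokesRegularity-4052), line `recurrent-closing`: the BRIDGE stub
# `stub_slabProfileOfNonzero` — a nonzero element of `A_C` yields a singular slab profile of
# Albritton–Barker's local Type-I class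

Route `SymmetryModuliCount`, sub-problem `NavierStokesRegularity`.  Lead seat c3 (2026-08-17); skeleton
`Cruxes/ForcedSymmetry/Lines/recurrent_closing.lean` (gen 2).

The registered stub `stub_slabProfileOfNonzero` (first arrow of the factorisation
`X ⇐ Bridge ∘ RecurrentReduction ∘ RecurrentClosing ∘ RDSSLiouvilleInClass`): for `u ∈ A_C`
(`IsTypeIAncientMild C u`: smooth on `t < 0`, divergence free, KNSS-mild, `‖u‖ ≤ C/√(−t)`) with `u t x ≠ 0` for
some `t < 0`, there is a suitable weak solution `(w, q)` on the slab `ℝ³ × (−∞,0)` with weak spatial gradient `G`,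
`𝐈(ℝ³ × ℝ₋) < ∞` (Albritton–Barker's Type-I quantity over ALL parabolic balls), Type-I rate, and a backward singular
point at the space–time origin.  Proof = the landed chain of the route:

* far-past ledger `FarPastLedger_proof` (stmt-14060) ⇒ ledger constant `K`; pressure package `pressurePackage_of_ledger`;
  cubic bound `lintegral_parabolicCylinder_le`; hence `exists_singular_limit_of_parts`: a blow-down limit `W ∈ A_C` of `u`
  at a point where `u ≠ 0`, SINGULAR at `(0,0)` (persistence of singularities, A–B Prop. 2.3);
* `stub_pressureStructure` (p137885): a global classical pressure `p` of `W` on `(−∞,0)` and the KNSS near/far structure of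
  every classical pressure of every class member at unit scale;
* `unitOscBound_of_ledger`: the mean-free pressure bound `D_osc(Q(z,1)) ≤ D₁(C,K)` for the whole class (slice estimate
  `stub_sliceOscillation` p138269, far-shell sum `stub_fplFarShell`/`stub_fplCovering`, time integration
  `stub_oscTimeIntegration` p138261);
* `stub_oscAllScales` (p138164): the same bound on every parabolic ball of the slab;
* `stub_slabProfileOfBounds` (p138367): suitability on the slab, weak gradient `∇W`, `𝐈 < ∞`.

References: D. Albritton, T. Barker, J. Math. Fluid Mech. 21 (2019) = arXiv:1811.00502, Def. 2.1, Lemma 2.2, Prop. 2.3,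
§3 [AlbrittonBarker2019]; G. Koch, N. Nadirashvili, G. Seregin, V. Šverák, Acta Math. 203 (2009), §3–4, §6
[KochNadirashviliSereginSverak2009].
-/

noncomputable section

-- the summit and its single problem share the name (D-0017 nested layout)
set_option linter.dupNamespace false

open MeasureTheory Set Metric Filter Function Topology
open scoped ENNReal NNReal
open Literature.Analysis.FluidPDE

namespace Summit.NavierStokesRegularity.NavierStokesRegularity.Theorems.SymmetryModuliCountForcedSymmetry

/-! ### The bridge -/

/-- The ledger constant of a class member is nonnegative. [folklore] -/
theorem farPastLedgerConst_nonneg {K : ℝ} {u : ℝ → EuclideanSpace ℝ (Fin 3) → EuclideanSpace ℝ (Fin 3)}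
    (hK : ∀ t < 0, ∀ (x₀ : EuclideanSpace ℝ (Fin 3)) (R : ℝ), 0 < R → ∫ x in ball x₀ R, ‖u t x‖ ^ 2 ≤ K * R) :
    0 ≤ K := by
  have h := hK (-1) (by norm_num) 0 1 one_pos
  have h0 : 0 ≤ ∫ x in ball (0 : EuclideanSpace ℝ (Fin 3)) 1, ‖u (-1) x‖ ^ 2 :=
    integral_nonneg fun x => sq_nonneg _
  linarith

/-- **The unit-scale mean-free pressure bound for the ledger class** (the landed sub-stubs `stub_pressureStructure`, `stub_sliceOscillation`, `stub_oscTimeIntegration` glued with the far-shell sum):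
for every `C, K` there are `D₁ ≥ 0` such that every classical pressure `q` on `(−∞,0)` of every `v ∈ A_C` with ledger `K`
has `D_osc(Q(z,1); q) ≤ D₁` at every centre with `z.1 ≤ 0`.  Constants: `M₁ = c₁ (4 c₀ C² K)^{3/4}` (near part, ledger on
`B(x₀,4)`), `M₂ = c₁ (c₀ c_S K)^{3/2}` (far part, `stub_fplFarShell` + `stub_fplCovering`), `D₁ = 4M₁ + M₂`.
[cite: KochNadirashviliSereginSverak2009, §3–4; AlbrittonBarker2019, §3] -/
theorem unitOscBound_of_ledger (C K : ℝ) :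
    ∃ D₁ : ℝ, 0 ≤ D₁ ∧
      ∀ (v : ℝ → EuclideanSpace ℝ (Fin 3) → EuclideanSpace ℝ (Fin 3)) (q : ℝ → EuclideanSpace ℝ (Fin 3) → ℝ),
        IsTypeIAncientMild C v →
        (∀ t < 0, ∀ (x₀ : EuclideanSpace ℝ (Fin 3)) (R : ℝ), 0 < R → ∫ x in ball x₀ R, ‖v t x‖ ^ 2 ≤ K * R) →
        IsClassicalNSSolutionOn (Set.Iio 0) 1 0 v q →
        ∀ z : ℝ × EuclideanSpace ℝ (Fin 3), z.1 ≤ 0 → cknDOsc 1 z q ≤ ENNReal.ofReal D₁ := by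
  obtain ⟨c₀, hc₀, hT1⟩ := stub_pressureStructure
  obtain ⟨c₁, hc₁, hT2⟩ := stub_sliceOscillation
  obtain ⟨cS, hcS, hS⟩ := Summit.NavierStokesRegularity.NavierStokesRegularity.Theorems.stub_fplFarShell
  have hfar := hS Summit.NavierStokesRegularity.NavierStokesRegularity.Theorems.stub_fplCovering
  by_cases hK0 : 0 ≤ K
  swap
  · -- no member carries a negative ledger constant: the bound is vacuous
    refine ⟨0, le_rfl, fun v q hv hKv hq z hz => absurd (farPastLedgerConst_nonneg hKv) hK0⟩
  have hC0' : 0 ≤ C ^ 2 := sq_nonneg C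
  set M₁ : ℝ := c₁ * (c₀ * C ^ 2 * (K * 4)) ^ (3 / 4 : ℝ) with hM₁
  set M₂ : ℝ := c₁ * (c₀ * (cS * K)) ^ (3 / 2 : ℝ) with hM₂
  have hM₁0 : 0 ≤ M₁ := mul_nonneg hc₁ (Real.rpow_nonneg (by positivity) _)
  have hM₂0 : 0 ≤ M₂ := mul_nonneg hc₁ (Real.rpow_nonneg (by positivity) _)
  refine ⟨4 * M₁ + M₂, by positivity, fun v q hv hKv hq z hz => ?_⟩
  refine stub_oscTimeIntegration M₁ M₂ q hM₁0 hM₂0 hq.smooth_pressure.continuousOn ?_ z hz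
  intro τ hτ x₀
  have hτ' : 0 < -τ := neg_pos.2 hτ
  obtain ⟨c, p₁, p₂, hdec, hmem, hA, hB⟩ := (hT1 C v hv).2 q hq τ hτ x₀
  -- the two constants of the slice
  set A : ℝ := c₀ * (C ^ 2 / (-τ)) * ∫ x in ball x₀ 4, ‖v τ x‖ ^ 2 with hAdef
  set B : ℝ := c₀ * ∫ y in (ball x₀ 3)ᶜ, ‖v τ y‖ ^ 2 / ‖y - x₀‖ ^ 4 with hBdef
  have hqcont : ContinuousOn (q τ) (ball x₀ 2) := (hq.contDiff_pressure hτ).continuous.continuousOn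
  have key := hT2 (q τ) p₁ p₂ c A B x₀ hqcont hdec hmem hA (fun x hx => hB x hx)
  refine key.trans (ENNReal.ofReal_le_ofReal ?_)
  -- `A ≤ (4 c₀ C² K)/(−τ)` by the ledger on `B(x₀,4)`
  have hI4 : ∫ x in ball x₀ 4, ‖v τ x‖ ^ 2 ≤ K * 4 := hKv τ hτ x₀ 4 (by norm_num)
  have hI4nn : 0 ≤ ∫ x in ball x₀ 4, ‖v τ x‖ ^ 2 := integral_nonneg fun x => sq_nonneg _
  have hA0 : 0 ≤ A := by rw [hAdef]; positivity
  have hAle : A ≤ (c₀ * C ^ 2 * (K * 4)) * (-τ)⁻¹ := by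
    rw [hAdef]
    have : c₀ * (C ^ 2 / (-τ)) * ∫ x in ball x₀ 4, ‖v τ x‖ ^ 2 ≤ c₀ * (C ^ 2 / (-τ)) * (K * 4) :=
      mul_le_mul_of_nonneg_left hI4 (by positivity)
    refine this.trans (le_of_eq ?_)
    field_simp
  -- `B ≤ c₀ c_S K` by the far-shell sum fed with the unit-ball ledger
  have hg : Continuous fun y => ‖v τ y‖ ^ 2 := (hv.continuous_slice hτ).norm.pow 2
  have hgM : ∃ M : ℝ, ∀ y, ‖v τ y‖ ^ 2 ≤ M :=
    ⟨(C / Real.sqrt (-τ)) ^ 2, fun y => pow_le_pow_left₀ (norm_nonneg _) (hv.norm_le hτ y) 2⟩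
  have hunit : ∀ z : EuclideanSpace ℝ (Fin 3), ∫ x in ball z 1, ‖v τ x‖ ^ 2 ≤ K := fun z => by
    simpa using hKv τ hτ z 1 one_pos
  have hfarB : ∫ y in (ball x₀ 3)ᶜ, ‖v τ y‖ ^ 2 / ‖y - x₀‖ ^ 4 ≤ cS * K :=
    (hfar (fun y => ‖v τ y‖ ^ 2) hg (fun y => sq_nonneg _) hgM K x₀ hunit).2
  have hB0 : 0 ≤ B := by
    rw [hBdef]
    refine mul_nonneg hc₀ (setIntegral_nonneg measurableSet_ball.compl fun y _ => ?_)
    positivity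
  have hBle : B ≤ c₀ * (cS * K) := by
    rw [hBdef]; exact mul_le_mul_of_nonneg_left hfarB hc₀
  -- powers
  have h34 : A ^ (3 / 4 : ℝ) ≤ (c₀ * C ^ 2 * (K * 4)) ^ (3 / 4 : ℝ) * (-τ) ^ (-(3 / 4 : ℝ)) := by
    calc A ^ (3 / 4 : ℝ) ≤ ((c₀ * C ^ 2 * (K * 4)) * (-τ)⁻¹) ^ (3 / 4 : ℝ) :=
          Real.rpow_le_rpow hA0 hAle (by norm_num)
      _ = (c₀ * C ^ 2 * (K * 4)) ^ (3 / 4 : ℝ) * ((-τ)⁻¹) ^ (3 / 4 : ℝ) :=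
          Real.mul_rpow (by positivity) (by positivity)
      _ = (c₀ * C ^ 2 * (K * 4)) ^ (3 / 4 : ℝ) * (-τ) ^ (-(3 / 4 : ℝ)) := by
          rw [Real.rpow_neg hτ'.le, Real.inv_rpow hτ'.le]
  have h32 : B ^ (3 / 2 : ℝ) ≤ (c₀ * (cS * K)) ^ (3 / 2 : ℝ) :=
    Real.rpow_le_rpow hB0 hBle (by norm_num)
  calc c₁ * (A ^ (3 / 4 : ℝ) + B ^ (3 / 2 : ℝ))
      ≤ c₁ * ((c₀ * C ^ 2 * (K * 4)) ^ (3 / 4 : ℝ) * (-τ) ^ (-(3 / 4 : ℝ)) + (c₀ * (cS * K)) ^ (3 / 2 : ℝ)) :=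
        mul_le_mul_of_nonneg_left (add_le_add h34 h32) hc₁
    _ = M₁ * (-τ) ^ (-(3 / 4 : ℝ)) + M₂ := by rw [hM₁, hM₂]; ring

/-- **Every element of `A_C` is a slab profile of Albritton–Barker's local Type-I class** (`A_C ⊂ 𝒦`): for
`v ∈ A_C` there is a pressure `p` with `(v, p)` classical on `(−∞,0)`, a suitable weak solution on the slab `ℝ³ × (−∞,0)`,
weak spatial gradient `∇v`, and `𝐈(ℝ³ × ℝ₋) < ∞`.  Chain: ledger (`FarPastLedger_proof`), global pressure
(`stub_pressureStructure`), mean-free pressure bound (`unitOscBound_of_ledger`, `stub_oscAllScales`), packaging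
(`stub_slabProfileOfBounds`).  This answers Albritton–Barker 2019 Remark 3.2 for ANCIENT Type-I mild solutions.
[cite: AlbrittonBarker2019, Def. 2.1, Remark 3.2 and §3; KochNadirashviliSereginSverak2009, §3–4] -/
theorem slabProfile_of_isTypeIAncientMild {C : ℝ} {v : ℝ → EuclideanSpace ℝ (Fin 3) → EuclideanSpace ℝ (Fin 3)}
    (hv : IsTypeIAncientMild C v) :
    ∃ p : ℝ → EuclideanSpace ℝ (Fin 3) → ℝ,
      IsClassicalNSSolutionOn (Set.Iio 0) 1 0 v p ∧
      IsSuitableWeakSolutionOn (slab (EuclideanSpace ℝ (Fin 3)) (Set.Iio 0) isOpen_Iio) 1 0 v p ∧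
      HasWeakSpatialGradientOn (slab (EuclideanSpace ℝ (Fin 3)) (Set.Iio 0) isOpen_Iio) v
        (fun t x => fderiv ℝ (v t) x) ∧
      typeIBound (Set.Iio (0 : ℝ) ×ˢ Set.univ) v p (fun t x => fderiv ℝ (v t) x) < ⊤ := by
  obtain ⟨K, hK⟩ := stub_lerayRateEnergy_of_farPastLedger
    Summit.NavierStokesRegularity.NavierStokesRegularity.Theorems.FarPastLedger_proof C v hv
  obtain ⟨c₀, -, hT1⟩ := stub_pressureStructure
  obtain ⟨⟨p, hp⟩, -⟩ := hT1 C v hv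
  obtain ⟨D₁, -, hunit⟩ := unitOscBound_of_ledger C K
  have hall := stub_oscAllScales C K D₁ hunit v p hv hK hp
  obtain ⟨hsw, hwg, hI⟩ := stub_slabProfileOfBounds C K D₁ v p hv hK hp hall
  exact ⟨p, hp, hsw, hwg, hI⟩

/-- **The BRIDGE `stub_slabProfileOfNonzero` of the line `recurrent-closing` (registered stub, proved)**: a nonzero
element of `A_C` yields a slab profile of Albritton–Barker's local Type-I class, singular at the origin.  Given `u ∈ A_C`
with `u t x ≠ 0` for some `t < 0`: the far-past ledger (`FarPastLedger_proof`, stmt-14060), the pressure package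
(`pressurePackage_of_ledger`) and the cubic bound (`lintegral_parabolicCylinder_le`) feed `exists_singular_limit_of_parts`,
whose blow-down limit `W ∈ A_C` is SINGULAR at `(0,0)`; `slabProfile_of_isTypeIAncientMild` packages `W`; the rate is
`C' = C`, the gradient `G = ∇W`.
[cite: AlbrittonBarker2019, Def. 2.1, Lemma 2.2, Prop. 2.3 and §3; KochNadirashviliSereginSverak2009, §3–4] -/
theorem stub_slabProfileOfNonzero :
    ∀ (C : ℝ) (u : ℝ → EuclideanSpace ℝ (Fin 3) → EuclideanSpace ℝ (Fin 3)),
      Literature.Analysis.FluidPDE.IsTypeIAncientMild C u →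
      (∃ t : ℝ, t < 0 ∧ ∃ x : EuclideanSpace ℝ (Fin 3), u t x ≠ 0) →
      ∃ (w : ℝ → EuclideanSpace ℝ (Fin 3) → EuclideanSpace ℝ (Fin 3)) (q : ℝ → EuclideanSpace ℝ (Fin 3) → ℝ)
        (G : ℝ → EuclideanSpace ℝ (Fin 3) → EuclideanSpace ℝ (Fin 3) →L[ℝ] EuclideanSpace ℝ (Fin 3)) (C' : ℝ),
        Literature.Analysis.FluidPDE.IsSuitableWeakSolutionOn
            (Literature.Analysis.FluidPDE.slab (EuclideanSpace ℝ (Fin 3)) (Set.Iio 0) isOpen_Iio) 1 0 w q ∧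
        Literature.Analysis.FluidPDE.HasWeakSpatialGradientOn
            (Literature.Analysis.FluidPDE.slab (EuclideanSpace ℝ (Fin 3)) (Set.Iio 0) isOpen_Iio) w G ∧
        Literature.Analysis.FluidPDE.typeIBound (Set.Iio (0 : ℝ) ×ˢ Set.univ) w q G < ⊤ ∧
        Literature.Analysis.FluidPDE.HasTypeITimeDecay C' w ∧
        Literature.Analysis.FluidPDE.IsBackwardSingularPoint w 0 := by
  intro C u hu hne
  obtain ⟨t₀, ht₀, x₀, hx₀⟩ := hne
  -- the ledger, the pressure package and the cubic bound of the class `A_C ∩ {ledger K}`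
  obtain ⟨K, hK⟩ := stub_lerayRateEnergy_of_farPastLedger
    Summit.NavierStokesRegularity.NavierStokesRegularity.Theorems.FarPastLedger_proof C u hu
  obtain ⟨D₀, hD₀⟩ := pressurePackage_of_ledger C K
  have hcubic : ∀ w : ℝ → EuclideanSpace ℝ (Fin 3) → EuclideanSpace ℝ (Fin 3), IsTypeIAncientMild C w →
      (∀ t < 0, ∀ (x₀ : EuclideanSpace ℝ (Fin 3)) (R : ℝ), 0 < R →
        ∫ x in ball x₀ R, ‖w t x‖ ^ 2 ≤ K * R) →
      ∫⁻ z in parabolicCylinder 1 (0 : ℝ × EuclideanSpace ℝ (Fin 3)), ‖w z.1 z.2‖ₑ ^ (3 : ℕ) ≤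
        ENNReal.ofReal (2 * C * K) := fun w hw hKw => by
    simpa using Summit.NavierStokesRegularity.NavierStokesRegularity.Theorems.AxisymEndLiouvilleOfFarPastLedger.lintegral_parabolicCylinder_le
      hw hKw (z := (0 : ℝ × EuclideanSpace ℝ (Fin 3))) le_rfl one_pos
  -- the singular blow-down limit `W ∈ A_C`, packaged
  obtain ⟨t₁, x₁, c, W, -, -, -, hW, -, hsing⟩ :=
    Summit.NavierStokesRegularity.NavierStokesRegularity.Theorems.ForcedSymmetry.BlowDownCensus.exists_singular_limit_of_parts
      C K D₀ hcubic hD₀ u hu hK t₀ x₀ ht₀ hx₀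
  obtain ⟨p, -, hsw, hwg, hI⟩ := slabProfile_of_isTypeIAncientMild hW
  exact ⟨W, p, fun t x => fderiv ℝ (W t) x, C, hsw, hwg, hI, hW.hasTypeITimeDecay, hsing⟩

end Summit.NavierStokesRegularity.NavierStokesRegularity.Theorems.SymmetryModuliCountForcedSymmetry

end
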